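import Summits.CriticalPhenomena.PercolationContinuityZ3.Theorems.PercNearOneGluingNoHeavyLowerTailSunflowerCompositionChain
import HarnessLib
import HarnessLib.Audit

/-!
# `NoHeavyLowerTail` (crux stmt-CriticalPhenomena-4575), abstract sunflower cubic: a `decide`-friendly criterion for COMB_chain of a
# chain-composition quotient — class fibre sums over SORTED classes are sums over blockwise rearrangements

Support file (seat `prim-ineq-gen-2` gen 20; `--supports stmt-CriticalPhenomena-4575`).  Nothing is asserted about the crux; no `sorry`, no named facts.
Memo: run/shared/lean/prim/prim-ineq-gen-2/THREEBLOCK-GEN20.md.  Companion (the instance): `…SunflowerCyclicStarPartition` (★ on all cyclic stars).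

SETTING (prim-l12-p2 g9, `…SunflowerCompositionChain`): for a quotient sunflower `G` on the threshold set `Σ b, Fin (r b)` and a kernel `κ`,
`ZFC κ G c = Σ_{L : clsC L = c} KC κ G L` is the fibre sum over the level-triple families `L` (one level triple `Fin 3 → Fin (r b + 1)` per block) whose
blockwise sorted form (`clsC`, via `Tuple.sort`) is `c`; `Sunflower.Zp_composeC_nonneg_of_comb`: `(∀ c, 0 ≤ ZFC κ G c) → 0 ≤ Zκ(G ∘ h)` for every family `h`
of chain gadgets of heights `r`.  As stated, `∀ c, 0 ≤ ZFC κ G c` is not kernel-decidable in practice (a sum over all `L` filtered through `Tuple.sort`, for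
every `c`).

THIS FILE (general blocks `B` and heights `r`).
* `rearr u` — the (at most six) rearrangements `u ∘ σ` of a level triple `u`, via the explicit list `perm3` of the permutations of `Fin 3`
  (`exists_perm3_coe_eq`: it is all of them); `rearrI u` — the same set as an explicit image over plain functions (`perm3f`, `rearrI_eq`), which the
  kernel evaluates cheaply.
* `canonC_eq_iff_mem_rearr`: for a SORTED `u`, `canonC t = u ↔ t ∈ rearr u`; hence `filter_clsC_eq_piFinset`: the families of a blockwise sorted class
  `c` are exactly `Fintype.piFinset (fun b => rearr (c b))`, **`ZFC_eq_sum_piFinset`**, and `ZFC_eq_zero_of_not_monotone` (an unsorted `c` has no families).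
* **`comb_chain_of_sorted`**: COMB_chain(`G`) follows from `0 ≤ Σ_{L ∈ Π_b rearr (c b)} KC κ G L` for the blockwise sorted `c` only — for three blocks of
  heights `2` these are `10³` classes of at most `6³` terms, within reach of `decide +kernel` once `KC` is tabulated (companion file).
-/

namespace Summit.CriticalPhenomena.PercolationContinuityZ3.Theorems.SunflowerPartition

open Finset

namespace ChainComb

/-! ## Rearrangements of a level triple -/

/-- The six permutations of `Fin 3`, as equivalences. [folklore] -/
def perm3 : Fin 6 → Equiv.Perm (Fin 3) :=
  ![1, Equiv.swap 0 1, Equiv.swap 0 2, Equiv.swap 1 2, Equiv.swap 0 1 * Equiv.swap 1 2, Equiv.swap 1 2 * Equiv.swap 0 1]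

/-- Every permutation of `Fin 3` is one of the six, as a function. [folklore] -/
theorem exists_perm3_coe_eq (τ : Equiv.Perm (Fin 3)) : ∃ i : Fin 6, ⇑(perm3 i) = ⇑τ := by
  have key : ∀ a b c : Fin 3, a ≠ b → a ≠ c → b ≠ c → ∃ i : Fin 6, ⇑(perm3 i) = ![a, b, c] := by decide
  have hinj := τ.injective
  obtain ⟨i, hi⟩ := key (τ 0) (τ 1) (τ 2) (fun h => absurd (hinj h) (by decide))
    (fun h => absurd (hinj h) (by decide)) (fun h => absurd (hinj h) (by decide))
  refine ⟨i, ?_⟩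
  rw [hi]
  funext x
  fin_cases x <;> rfl

variable {n : ℕ}

/-- The blockwise rearrangements of a triple of levels. [this work] -/
def rearr (u : Fin 3 → Fin (n + 1)) : Finset (Fin 3 → Fin (n + 1)) :=
  univ.filter fun t => ∃ i : Fin 6, t = u ∘ ⇑(perm3 i)

/-- The six permutations of `Fin 3` as plain functions (for kernel evaluation). [folklore] -/
def perm3f : Fin 6 → Fin 3 → Fin 3 :=
  ![![0, 1, 2], ![1, 0, 2], ![2, 1, 0], ![0, 2, 1], ![1, 2, 0], ![2, 0, 1]]

/-- `perm3` and `perm3f` agree. [folklore] -/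
theorem coe_perm3 : ∀ i : Fin 6, ⇑(perm3 i) = perm3f i := by
  decide

/-- The rearrangements as an explicit image (for kernel evaluation). [this work] -/
def rearrI (u : Fin 3 → Fin (n + 1)) : Finset (Fin 3 → Fin (n + 1)) :=
  (univ : Finset (Fin 6)).image fun i => u ∘ perm3f i

/-- `rearrI = rearr`. [this work] -/
theorem rearrI_eq (u : Fin 3 → Fin (n + 1)) : rearrI u = rearr u := by
  ext t
  simp only [rearrI, rearr, mem_image, mem_filter, mem_univ, true_and]
  constructor
  · rintro ⟨i, hi⟩
    exact ⟨i, by rw [coe_perm3, hi]⟩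
  · rintro ⟨i, hi⟩
    exact ⟨i, by rw [← coe_perm3, hi]⟩

/-- A sorted triple is its own canonical (sorted) form. [folklore] -/
theorem canonC_eq_self_of_monotone {u : Fin 3 → Fin (n + 1)} (hu : Monotone u) : canonC u = u := by
  unfold canonC
  rw [Tuple.sort_eq_refl_iff_monotone.2 hu]
  rfl

/-- The canonical form of a triple is sorted. [folklore] -/
theorem monotone_canonC (u : Fin 3 → Fin (n + 1)) : Monotone (canonC u) :=
  Tuple.monotone_sort u

/-- For a sorted `u`: `canonC t = u` iff `t` is a rearrangement of `u`. [this work] -/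
theorem canonC_eq_iff_mem_rearr {u : Fin 3 → Fin (n + 1)} (hu : Monotone u) (t : Fin 3 → Fin (n + 1)) :
    canonC t = u ↔ t ∈ rearr u := by
  rw [rearr, mem_filter]
  constructor
  · intro h
    refine ⟨mem_univ _, ?_⟩
    obtain ⟨i, hi⟩ := exists_perm3_coe_eq (Tuple.sort t).symm
    refine ⟨i, ?_⟩
    rw [hi, ← h]
    funext x
    simp only [canonC, Function.comp_apply, Equiv.apply_symm_apply]
  · rintro ⟨_, i, hi⟩
    rw [hi, canonC_comp_perm]
    exact canonC_eq_self_of_monotone hu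

/-! ## Class fibre sums over sorted classes -/

variable {B : Type*} [Fintype B] [DecidableEq B] {r : B → ℕ}

/-- For a blockwise sorted class `c`, the level-triple families of class `c` are exactly the blockwise rearrangements of `c`. [this work] -/
theorem filter_clsC_eq_piFinset (c : ∀ b, Fin 3 → Fin (r b + 1)) (hc : ∀ b, Monotone (c b)) :
    (univ : Finset (∀ b, Fin 3 → Fin (r b + 1))).filter (fun L => clsC L = c) = Fintype.piFinset fun b => rearr (c b) := by
  ext L
  simp only [mem_filter, mem_univ, true_and, Fintype.mem_piFinset]
  constructor
  · intro h b
    rw [← canonC_eq_iff_mem_rearr (hc b)]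
    exact congrFun h b
  · intro h
    funext b
    exact (canonC_eq_iff_mem_rearr (hc b) (L b)).2 (h b)

/-- **Class fibre sums over sorted classes are sums over rearrangements.** [this work] -/
theorem ZFC_eq_sum_piFinset (κ : Fin 5 → Fin 5 → Fin 5 → ℤ) (G : Sunflower (Σ b, Fin (r b))) (c : ∀ b, Fin 3 → Fin (r b + 1))
    (hc : ∀ b, Monotone (c b)) :
    ZFC κ G c = ∑ L ∈ Fintype.piFinset (fun b => rearr (c b)), KC κ G L := by
  unfold ZFC
  rw [filter_clsC_eq_piFinset c hc]

/-- An unsorted class has no families: its fibre sum vanishes. [this work] -/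
theorem ZFC_eq_zero_of_not_monotone (κ : Fin 5 → Fin 5 → Fin 5 → ℤ) (G : Sunflower (Σ b, Fin (r b))) (c : ∀ b, Fin 3 → Fin (r b + 1))
    {b : B} (hb : ¬ Monotone (c b)) : ZFC κ G c = 0 := by
  unfold ZFC
  refine sum_eq_zero fun L hL => ?_
  exfalso
  rw [mem_filter] at hL
  apply hb
  rw [← hL.2]
  exact monotone_canonC (L b)

/-- **COMB_chain from the sorted classes**: it suffices to check, for every blockwise sorted `c`, that the kernel summed over the blockwise
rearrangements of `c` is nonnegative. [this work] -/
theorem comb_chain_of_sorted (κ : Fin 5 → Fin 5 → Fin 5 → ℤ) (G : Sunflower (Σ b, Fin (r b)))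
    (H : ∀ c : (∀ b, Fin 3 → Fin (r b + 1)), (∀ b, Monotone (c b)) →
      0 ≤ ∑ L ∈ Fintype.piFinset (fun b => rearr (c b)), KC κ G L) :
    ∀ c : (∀ b, Fin 3 → Fin (r b + 1)), 0 ≤ ZFC κ G c := by
  intro c
  by_cases hc : ∀ b, Monotone (c b)
  · rw [ZFC_eq_sum_piFinset κ G c hc]
    exact H c hc
  · obtain ⟨b, hb⟩ := not_forall.1 hc
    rw [ZFC_eq_zero_of_not_monotone κ G c hb]

end ChainComb

end Summit.CriticalPhenomena.PercolationContinuityZ3.Theorems.SunflowerPartition
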